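import Summits.BirchSwinnertonDyer.BirchSwinnertonDyer.Theorems.ResidualThetaTransportAtTwoResidualSignedLambdaLowerCMAtTwoRhoLayerPairingCompat
import Summits.BirchSwinnertonDyer.BirchSwinnertonDyer.Theorems.ResidualThetaTransportAtTwoResidualSignedLambdaLowerCMAtTwoSelfDualTower
import Summits.BirchSwinnertonDyer.BirchSwinnertonDyer.Theorems.ResidualThetaTransportAtTwoResidualSignedLambdaLowerCMAtTwoDetCyclotomic
import HarnessLib

/-!
# K-b2: the `ρ`-coefficient layer Tate pairings are COMPATIBLE along `ℤ/p^{k+1} → ℤ/p^k` (`rhoLayerPairingPk_succ_compat`), hence THE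
# pinned `ℤ_p`-valued family `CyclotomicLayer.rhoLayerPairingAdic` EXISTS for the crux's `ρ` (self-dual tower + `det ρ = ε₂`)

Route `ResidualThetaTransportAtTwo` (RTT), crux RSL_g `ResidualSignedLambdaLowerCMAtTwo` (stmt-BirchSwinnertonDyer-22608); seat `prover-bsd-wall-rtt-p2` g17
(`--supports`, closes nothing). THEOREMS ONLY (no definition, no named fact, no instance, no `sorry`). BSD is not proved by any of this; RSL_g is not
proved here. This is item K-b2 of `Cruxes/ResidualThetaCountLowerPureAtTwo/SKELETON-V2-CUT-g16.md` §3 / STUB-PLAN rev 11 §0.4: the pin on which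
the deep-half and reciprocity stubs of the 22608 line are stated.

WHAT.
* §1 (generic coefficient modules `M → M'`, levels `p^{k+1} → p^k`): **`layerPairingH1Of_succ_compat`** — for a morphism `f : M → M'` of finite
  discrete Galois modules and pairing data with `e'(f a, f b) = e(a, b)^p`, the two-argument layer pairings of `CyclotomicLayerPairingOfFun` satisfy
  `⟨x, y⟩_{n,p^{k+1}} mod p^k = ⟨f_* x, f_* y⟩_{n,p^k}`: squares (3) Shapiro (`shapiroLift_cohomologyMap`), (5) summed cup products
  (`ContPairing.cupProduct_coindFin_map`), (6) THE invariant maps (TP2 `invAt_cohomologyMap_muLocalPow`).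
* §2 **`rhoLayerPairingPk_succ_compat`** — with `f := [p] : A_ρ[p^{k+1}] → A_ρ[p^k]` (`cofreeTorsionPow`, p676533) and a TOWER `ePk`
  (`e_k(pa, pb) = e_{k+1}(a, b)^p`): `rhoLayerPairingPk … n (k+1) x Q mod p^k = rhoLayerPairingPk … n k x Q`, by §1 and the landed `ρ`-squares
  (1)+(2) `layerLocOf_reduce_succ`, (4) `cohomologyMap_cofreeTorsionLocalPow_thetaLayerKummer` — the `ρ`-twin of TP2's `layerPairingPk_succ_compat`.
* §3 **`exists_cofreeWedgeTower_pow`** — the self-dual tower of p675174 in the `cofreeTorsionPow` form of §2's hypothesis (any rank-two `ρ` with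
  `det ρ = ε` in `𝒪`, any `ℤ_p`-linear `λ : 𝒪 → ℤ_p`, a compatible system of primitive roots of unity).
* §4 **`exists_rhoLayerPairingAdic_of_frobCharpoly_shape`** — for the crux's `ρ` (Frobenius polynomials `X² − a_v X + ℓ_v` off `2M`, so `det ρ = ε₂`
  by p674333) and every `λ`: there are tower data `(ePk, hμ, hadd₁, hadd₂, hgal)` with the value formula of p675174 and `hcompat` at EVERY layer `n`;
  in particular a `ℤ_2`-valued family `pair n : H¹(Γ_n, T_ρ) →+ (E(ℚ_{n,v})^r →+ ℤ_2)` whose residues are the `rhoLayerPairingPk` (namely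
  `rhoLayerPairingAdic … n (hcompat n)`), unique by `eq_of_forall_toZModPow_eq_rhoLayerPairingPk`.

References: [Kato2004Asterisque] §13.8 (pp. 228–229), §14.9 (p. 239); [PerrinRiou1994Invent] §3.6.1; [Kobayashi2003] (8.23) (p. 18);
[SerreLocalFields1979] XIII §3; [NeukirchSchmidtWingberg2008] I §4 (1.4.2), I §6 (1.6.4).
-/

set_option autoImplicit false
-- the Theorems namespace of this sub repeats the summit name by design (D-0017 nested layout)
set_option linter.dupNamespace false

noncomputable section

open scoped Classical

namespace Summit.BirchSwinnertonDyer.BirchSwinnertonDyer.Theorems.ThetaTransport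

open CategoryTheory Field NumberField IsDedekindDomain WeierstrassCurve
  Literature.NumberTheory.EllipticCurves Literature.NumberTheory.GaloisRepresentations
  Literature.NumberTheory.EllipticCurves.Kobayashi2003
  Literature.NumberTheory.EllipticCurves.GreenbergSelmer Literature.NumberTheory.EllipticCurves.CyclotomicLayer
  Literature.NumberTheory.GaloisCohomology ZpExtension

attribute [local instance] absoluteGaloisGroup_compactSpace

/-! ## §1 Generic coefficients: `⟨x, y⟩_{n,p^{k+1}} mod p^k = ⟨f_* x, f_* y⟩_{n,p^k}` -/

section Generic

variable {p : ℕ} [Fact p.Prime] (k : ℕ) {M M' : Type} [AddCommGroup M] [TopologicalSpace M] [DiscreteTopology M]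
  [AddCommGroup M'] [TopologicalSpace M'] [DiscreteTopology M']
  (ρM : DiscreteGaloisModule ℚ M) (ρM' : DiscreteGaloisModule ℚ M') (f : ρM.toTopRep ⟶ ρM'.toTopRep)
  (e : M → M → AlgebraicClosure ℚ)
  (hμ : ∀ S T, e S T ^ (p ^ (k + 1)) = 1)
  (hadd₁ : ∀ S₁ S₂ T, e (S₁ + S₂) T = e S₁ T * e S₂ T)
  (hadd₂ : ∀ S T₁ T₂, e S (T₁ + T₂) = e S T₁ * e S T₂)
  (hgal : ∀ (σ : absoluteGaloisGroup ℚ) (S T : M), σ • e S T = e (ρM σ S) (ρM σ T))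
  (e' : M' → M' → AlgebraicClosure ℚ)
  (hμ' : ∀ S T, e' S T ^ (p ^ k) = 1)
  (hadd₁' : ∀ S₁ S₂ T, e' (S₁ + S₂) T = e' S₁ T * e' S₂ T)
  (hadd₂' : ∀ S T₁ T₂, e' S (T₁ + T₂) = e' S T₁ * e' S T₂)
  (hgal' : ∀ (σ : absoluteGaloisGroup ℚ) (S T : M'), σ • e' S T = e' (ρM' σ S) (ρM' σ T))
  (hc : ∀ a b, e' (f.hom a) (f.hom b) = e a b ^ p)
  (κ : ZpExtension ℚ p) (v : HeightOneSpectrum (𝓞 ℚ))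

include hc in
/-- The module identity behind (5): `(e(a,b))^p = e'(f a, f b)` read on the carriers `μ` through `(·)^p : μ_{p^{k+1}}| → μ_{p^k}|`.
[cite: Kato2004Asterisque, §14.9 (p. 239)] [cite: NeukirchSchmidtWingberg2008, I §4 (1.4.2)] -/
theorem muLocalPow_localPairingOfFun (a b : M) :
    haveI : NeZero (p ^ k) := ⟨pow_ne_zero k (Fact.out : p.Prime).ne_zero⟩
    haveI : NeZero (p ^ (k + 1)) := ⟨pow_ne_zero (k + 1) (Fact.out : p.Prime).ne_zero⟩
    (SignedKatoOffTwo.LayerPairing.muLocalPow v k).hom ((localPairingOfFun ρM (p ^ (k + 1)) e hμ hadd₁ hadd₂ hgal v).toLin a b) =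
      (localPairingOfFun ρM' (p ^ k) e' hμ' hadd₁' hadd₂' hgal' v).toLin
        ((TopRep.ofHom (f.hom.restrictField (v.adicCompletion ℚ)) : localRepOf ρM v ⟶ localRepOf ρM' v).hom a)
        ((TopRep.ofHom (f.hom.restrictField (v.adicCompletion ℚ)) : localRepOf ρM v ⟶ localRepOf ρM' v).hom b) := by
  haveI : NeZero (p ^ k) := ⟨pow_ne_zero k (Fact.out : p.Prime).ne_zero⟩
  haveI : NeZero (p ^ (k + 1)) := ⟨pow_ne_zero (k + 1) (Fact.out : p.Prime).ne_zero⟩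
  apply muVal_injective ℚ (p ^ k)
  apply Units.ext
  rw [SignedKatoOffTwo.LayerPairing.muVal_muLocalPow, Units.val_pow_eq_pow_val, localPairingOfFun_toLin_apply, localPairingOfFun_toLin_apply]
  change (((DiscreteGaloisModule.MuCarrier.toAdditive (pairingHomOfFun (p ^ (k + 1)) e hμ hadd₁ hadd₂ a b)).toMul :
      (AlgebraicClosure ℚ)ˣ) : AlgebraicClosure ℚ) ^ p =
    (((DiscreteGaloisModule.MuCarrier.toAdditive (pairingHomOfFun (p ^ k) e' hμ' hadd₁' hadd₂' (f.hom a) (f.hom b))).toMul :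
      (AlgebraicClosure ℚ)ˣ) : AlgebraicClosure ℚ)
  rw [coe_pairingHomOfFun, coe_pairingHomOfFun]
  exact (hc a b).symm

omit [Fact p.Prime] in
/-- The two copies of THE local invariant map on `H²(Γ_v, μ_N|)` in the tree — `CyclotomicLayer.invAt` (Literature) and TP2's
`SignedKatoOffTwo.LayerPairing.invAt` — are the same term (`localInvariantMap ℚ N v`). [cite: MilneADT2006, Ch. I §1, Cor. 2.3] -/
theorem invAt_eq_layerPairingInvAt (N : ℕ) [NeZero N] :
    CyclotomicLayer.invAt N v = SignedKatoOffTwo.LayerPairing.invAt N v := rfl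

include hc in
/-- **(5) The cup products of the summed pairings are compatible along the level**:
`((·)^p)_* (a ∪_{Σe} b) = f_* a ∪_{Σe'} f_* b` (tree `ContPairing.cupProduct_coindFin_map`). [cite: NeukirchSchmidtWingberg2008, I §4 (1.4.2)] -/
theorem cupProduct_layerSumPairingOf_succ (n : ℕ)
    (a b : continuousCohomology 1 (coindFin.{0, 0} (localRepOf ρM v) (layerGroup κ v n))) :
    haveI : NeZero (p ^ k) := ⟨pow_ne_zero k (Fact.out : p.Prime).ne_zero⟩
    haveI : NeZero (p ^ (k + 1)) := ⟨pow_ne_zero (k + 1) (Fact.out : p.Prime).ne_zero⟩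
    cohomologyMap (SignedKatoOffTwo.LayerPairing.muLocalPow v k) 2 ((layerSumPairingOf ρM (p ^ (k + 1)) e hμ hadd₁ hadd₂ hgal κ v n).cupProduct a b) =
      (layerSumPairingOf ρM' (p ^ k) e' hμ' hadd₁' hadd₂' hgal' κ v n).cupProduct
        (cohomologyMap (coindFinMap ((TopRep.ofHom (f.hom.restrictField (v.adicCompletion ℚ)) : localRepOf ρM v ⟶ localRepOf ρM' v))
          (layerGroup κ v n)) 1 a)
        (cohomologyMap (coindFinMap ((TopRep.ofHom (f.hom.restrictField (v.adicCompletion ℚ)) : localRepOf ρM v ⟶ localRepOf ρM' v))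
          (layerGroup κ v n)) 1 b) := by
  haveI : NeZero (p ^ k) := ⟨pow_ne_zero k (Fact.out : p.Prime).ne_zero⟩
  haveI : NeZero (p ^ (k + 1)) := ⟨pow_ne_zero (k + 1) (Fact.out : p.Prime).ne_zero⟩
  letI : Fintype (absoluteGaloisGroup (v.adicCompletion ℚ) ⧸ layerGroup κ v n) := layerFintypeQuot κ v n
  unfold layerSumPairingOf
  exact ContPairing.cupProduct_coindFin_map _ _ _ _ _ (layerGroup κ v n)
    (fun a b => muLocalPow_localPairingOfFun k ρM ρM' f e hμ hadd₁ hadd₂ hgal e' hμ' hadd₁' hadd₂' hgal' hc v a b) a b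

include hc in
/-- **Level compatibility of the two-argument layer pairings for a morphism of coefficient modules** (`M → M'`, `p^{k+1} → p^k`):
`⟨x, y⟩_{n,p^{k+1}} mod p^k = ⟨f_* x, f_* y⟩_{n,p^k}` on `H¹(U_n, M|) × H¹(U_n, M|)` — squares (3) Shapiro, (5) summed cup products, (6) THE invariant
maps. [cite: PerrinRiou1994Invent, §3.6.1] [cite: SerreLocalFields1979, XIII §3 (Prop. 6–7)] [cite: NeukirchSchmidtWingberg2008, I §6 Prop. (1.6.4)] -/
theorem layerPairingH1Of_succ_compat (n : ℕ) (x y : continuousCohomology 1 (subgroupRep (localRepOf ρM v) (layerGroup κ v n))) :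
    haveI : NeZero (p ^ k) := ⟨pow_ne_zero k (Fact.out : p.Prime).ne_zero⟩
    haveI : NeZero (p ^ (k + 1)) := ⟨pow_ne_zero (k + 1) (Fact.out : p.Prime).ne_zero⟩
    (ZMod.cast (layerPairingH1Of ρM (p ^ (k + 1)) e hμ hadd₁ hadd₂ hgal κ v n x y) : ZMod (p ^ k)) =
      layerPairingH1Of ρM' (p ^ k) e' hμ' hadd₁' hadd₂' hgal' κ v n
        (cohomologyMap (subgroupRepMap (Y := localRepOf ρM' v) (TopRep.ofHom (f.hom.restrictField (v.adicCompletion ℚ))) (layerGroup κ v n)) 1 x)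
        (cohomologyMap (subgroupRepMap (Y := localRepOf ρM' v) (TopRep.ofHom (f.hom.restrictField (v.adicCompletion ℚ))) (layerGroup κ v n)) 1 y) := by
  haveI : NeZero (p ^ k) := ⟨pow_ne_zero k (Fact.out : p.Prime).ne_zero⟩
  haveI : NeZero (p ^ (k + 1)) := ⟨pow_ne_zero (k + 1) (Fact.out : p.Prime).ne_zero⟩
  have hcast : ∀ z : ZMod (p ^ (k + 1)), (ZMod.cast z : ZMod (p ^ k)) = ZMod.castHom (Dvd.intro p (SignedKatoOffTwo.LayerPairing.pow_mul_prime_eq k)) (ZMod (p ^ k)) z :=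
    fun z => rfl
  rw [hcast, layerPairingH1Of_apply, layerPairingH1Of_apply, invAt_eq_layerPairingInvAt, invAt_eq_layerPairingInvAt,
    ← SignedKatoOffTwo.LayerPairing.invAt_cohomologyMap_muLocalPow v k,
    cupProduct_layerSumPairingOf_succ k ρM ρM' f e hμ hadd₁ hadd₂ hgal e' hμ' hadd₁' hadd₂' hgal' hc κ v n]
  unfold layerShapiroOf
  rw [← shapiroLift_cohomologyMap, ← shapiroLift_cohomologyMap]

end Generic

/-! ## §2 `ρ`: `rhoLayerPairingPk … n (k+1) x Q mod p^k = rhoLayerPairingPk … n k x Q` for a tower `ePk` -/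

section Rho

variable {p : ℕ} [Fact p.Prime] (S : Set (PadicAlgCl p)) {d : ℕ} (ρ : FramedGaloisRep ℚ ↥(padicCoeffIntegers S) d)
  (W : WeierstrassCurve ℚ) [W.IsElliptic] {r : ℕ}
  (ePk : ∀ k : ℕ, ↥(AddSubgroup.torsionBy (Cofree ρ ↥(padicCoeffField S)) ((p ^ k : ℕ) : ℤ)) →
    ↥(AddSubgroup.torsionBy (Cofree ρ ↥(padicCoeffField S)) ((p ^ k : ℕ) : ℤ)) → AlgebraicClosure ℚ)
  (hμPk : ∀ k a b, ePk k a b ^ (p ^ k) = 1)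
  (hadd₁Pk : ∀ k a₁ a₂ b, ePk k (a₁ + a₂) b = ePk k a₁ b * ePk k a₂ b)
  (hadd₂Pk : ∀ k a b₁ b₂, ePk k a (b₁ + b₂) = ePk k a b₁ * ePk k a b₂)
  (hgalPk : ∀ k (σ : absoluteGaloisGroup ℚ) (a b : ↥(AddSubgroup.torsionBy (Cofree ρ ↥(padicCoeffField S)) ((p ^ k : ℕ) : ℤ))),
    σ • ePk k a b = ePk k (cofreeTorsionGaloisModule S ρ _ σ a) (cofreeTorsionGaloisModule S ρ _ σ b))
  (htower : ∀ k (a b : ↥(AddSubgroup.torsionBy (Cofree ρ ↥(padicCoeffField S)) ((p ^ (k + 1) : ℕ) : ℤ))),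
    ePk k ((cofreeTorsionPow S ρ k).hom a) ((cofreeTorsionPow S ρ k).hom b) = ePk (k + 1) a b ^ p)
  (Θ : Cofree ρ ↥(padicCoeffField S) ≃+ (Fin r → ↥(W.geomPrimaryTorsion p))) (κ : ZpExtension ℚ p)
  (v : HeightOneSpectrum (𝓞 ℚ))
  (hΘ : ∀ (δ : absoluteGaloisGroup (v.adicCompletion ℚ)) (m : Cofree ρ ↥(padicCoeffField S)) (i : Fin r),
    Θ (resGalOfEmb (closureEmb (K := ℚ) (v.adicCompletion ℚ)) δ • m) i =
      resGalOfEmb (closureEmb (K := ℚ) (v.adicCompletion ℚ)) δ • Θ m i)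

set_option maxHeartbeats 400000 in
include htower in
/-- **K-b: LEVEL COMPATIBILITY of the `ρ`-coefficient layer Tate pairings** — the hypothesis `hcompat` of
`CyclotomicLayer.rhoLayerPairingAdic`: for a TOWER of pairing data `ePk` (`e_k(pa, pb) = e_{k+1}(a, b)^p`),
`rhoLayerPairingPk … n (k+1) x Q mod p^k = rhoLayerPairingPk … n k x Q`. Six squares: (1)+(2) `layerLocOf_reduce_succ`, (4)
`cohomologyMap_cofreeTorsionLocalPow_thetaLayerKummer` (p676533), (3)(5)(6) `layerPairingH1Of_succ_compat` (§1). The `ρ`-twin of TP2's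
`SignedKatoOffTwo.LayerPairing.layerPairingPk_succ_compat`. [cite: Kato2004Asterisque, §13.8 (pp. 228–229)] [cite: PerrinRiou1994Invent, §3.6.1]
[cite: Kobayashi2003, (8.23) (p. 18)] -/
theorem rhoLayerPairingPk_succ_compat (n k : ℕ) (x : H1 (FramedGaloisRep.toGaloisRep ρ) (κ.layerSubgroup n))
    (Q : Fin r → localLayerPointsOfEmb κ (closureEmb (K := ℚ) (v.adicCompletion ℚ)) W n) :
    (ZMod.cast (rhoLayerPairingPk S ρ W ePk hμPk hadd₁Pk hadd₂Pk hgalPk Θ κ v hΘ n (k + 1) x Q) : ZMod (p ^ k)) =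
      rhoLayerPairingPk S ρ W ePk hμPk hadd₁Pk hadd₂Pk hgalPk Θ κ v hΘ n k x Q := by
  rw [rhoLayerPairingPk_apply, rhoLayerPairingPk_apply,
    layerPairingH1Of_succ_compat k (cofreeTorsionGaloisModule S ρ ((p ^ (k + 1) : ℕ) : ℤ)) (cofreeTorsionGaloisModule S ρ ((p ^ k : ℕ) : ℤ))
      (cofreeTorsionPow S ρ k) (ePk (k + 1)) (hμPk (k + 1)) (hadd₁Pk (k + 1)) (hadd₂Pk (k + 1)) (hgalPk (k + 1)) (ePk k) (hμPk k)
      (hadd₁Pk k) (hadd₂Pk k) (hgalPk k) (htower k) κ v n]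
  change layerPairingH1Of _ (p ^ k) (ePk k) (hμPk k) (hadd₁Pk k) (hadd₂Pk k) (hgalPk k) κ v n
      (cohomologyMap (subgroupRepMap (cofreeTorsionLocalPow S ρ k v) (layerGroup κ v n)) 1
        (layerLocOf (cofreeTorsionGaloisModule S ρ ((p ^ (k + 1) : ℕ) : ℤ)) κ v n (reduceH1CofreePkTorsion S ρ (k + 1) (κ.layerSubgroup n) x)))
      (cohomologyMap (subgroupRepMap (cofreeTorsionLocalPow S ρ k v) (layerGroup κ v n)) 1 (thetaLayerKummer S ρ (k + 1) W Θ κ v hΘ n Q)) = _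
  rw [← layerLocOf_reduce_succ, cohomologyMap_cofreeTorsionLocalPow_thetaLayerKummer]

end Rho

/-! ## §3 The self-dual tower of p675174 in the `cofreeTorsionPow` form -/

section Tower

variable {p : ℕ} [Fact p.Prime] (S : Set (PadicAlgCl p)) {d : ℕ} (ρ : FramedGaloisRep ℚ ↥(padicCoeffIntegers S) d)

/-- `[p] (p^{-k-1} s) = p^{-k} s`: `cofreeTorsionPow` on the representatives `divPowCofreeMkTorsion` (`smul_divPowCofreeMk_succ`).
[cite: Kato2004Asterisque, §13.8 (p. 228)] -/
theorem cofreeTorsionPow_divPowCofreeMkTorsion (k : ℕ) (s : Fin d → ↥(padicCoeffIntegers S)) :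
    (cofreeTorsionPow S ρ k).hom (divPowCofreeMkTorsion S ρ (k + 1) s) = divPowCofreeMkTorsion S ρ k s := by
  apply Subtype.ext
  change (p : ℤ) • (divPowCofreeMk S ρ (k + 1) s : Cofree ρ ↥(padicCoeffField S)) = divPowCofreeMk S ρ k s
  rw [natCast_zsmul, smul_divPowCofreeMk_succ]

/-- **The self-duality TOWER of a rank-two `ρ` with `det ρ = ε`** (K-a, p675174, re-packaged): for every `ℤ_p`-linear `λ : 𝒪 →+ ℤ_p` there are
pairing data `e_k : A_ρ[p^k] × A_ρ[p^k] → μ_{p^k}` — `μ_{p^k}`-valued, bi-multiplicative, `Γ_ℚ`-equivariant (the binders of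
`CyclotomicLayer.rhoLayerPairingPk`) — with the value formula `e_k(p^{-k}s, p^{-k}t) = ζ_k^{λ(s ∧ t) mod p^k}` for a compatible system `ζ` of
PRIMITIVE `p^k`-th roots of unity, forming a TOWER in the sense of `rhoLayerPairingPk_succ_compat`: `e_k([p]a, [p]b) = e_{k+1}(a, b)^p`.
[cite: Kato2004Asterisque, §14.9 (p. 239)] [cite: Nekovar2006, §0.11] -/
theorem exists_cofreeWedgeTower_pow (ρ : FramedGaloisRep ℚ ↥(padicCoeffIntegers S) 2)
    (hdet : ∀ σ : absoluteGaloisGroup ℚ, ((FramedRep.det ρ σ : (↥(padicCoeffIntegers S))ˣ) : ↥(padicCoeffIntegers S)) =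
      padicIntToCoeffIntegers S ((GaloisRep.cyclotomicCharacter ℚ p σ : ℤ_[p]ˣ) : ℤ_[p]))
    (lam : ↥(padicCoeffIntegers S) →+ ℤ_[p]) (hlam : ∀ (z : ℤ_[p]) (x : ↥(padicCoeffIntegers S)), lam (padicIntToCoeffIntegers S z * x) = z * lam x) :
    ∃ ePk : ∀ k : ℕ, ↥(AddSubgroup.torsionBy (Cofree ρ ↥(padicCoeffField S)) ((p ^ k : ℕ) : ℤ)) →
        ↥(AddSubgroup.torsionBy (Cofree ρ ↥(padicCoeffField S)) ((p ^ k : ℕ) : ℤ)) → AlgebraicClosure ℚ,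
      (∀ k a b, ePk k a b ^ (p ^ k) = 1) ∧
      (∀ k a₁ a₂ b, ePk k (a₁ + a₂) b = ePk k a₁ b * ePk k a₂ b) ∧
      (∀ k a b₁ b₂, ePk k a (b₁ + b₂) = ePk k a b₁ * ePk k a b₂) ∧
      (∀ k (σ : absoluteGaloisGroup ℚ) (a b : ↥(AddSubgroup.torsionBy (Cofree ρ ↥(padicCoeffField S)) ((p ^ k : ℕ) : ℤ))),
        σ • ePk k a b = ePk k (cofreeTorsionGaloisModule S ρ _ σ a) (cofreeTorsionGaloisModule S ρ _ σ b)) ∧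
      (∃ ζ : ℕ → AlgebraicClosure ℚ, (∀ k, IsPrimitiveRoot (ζ k) (p ^ k)) ∧ (∀ k, ζ (k + 1) ^ p = ζ k) ∧
        ∀ k (s t : Fin 2 → ↥(padicCoeffIntegers S)),
          ePk k (divPowCofreeMkTorsion S ρ k s) (divPowCofreeMkTorsion S ρ k t) =
            ζ k ^ (PadicInt.toZModPow k (lam (s 0 * t 1 - s 1 * t 0))).val) ∧
      (∀ k (a b : ↥(AddSubgroup.torsionBy (Cofree ρ ↥(padicCoeffField S)) ((p ^ (k + 1) : ℕ) : ℤ))),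
        ePk k ((cofreeTorsionPow S ρ k).hom a) ((cofreeTorsionPow S ρ k).hom b) = ePk (k + 1) a b ^ p) := by
  obtain ⟨ζ, hζprim, hζsucc⟩ := exists_primitiveRoot_tower p
  have hζ : ∀ k, ζ k ^ (p ^ k) = 1 := fun k => (hζprim k).pow_eq_one
  obtain ⟨ePk, hμ, hadd₁, hadd₂, hgal, hval, htower⟩ := exists_cofreeWedgeTower S ρ hdet lam hlam ζ hζ
  refine ⟨ePk, hμ, hadd₁, hadd₂, hgal, ⟨ζ, hζprim, hζsucc, hval⟩, fun k a b => ?_⟩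
  obtain ⟨s, rfl⟩ := divPowCofreeMkTorsion_surjective S ρ (k + 1) a
  obtain ⟨t, rfl⟩ := divPowCofreeMkTorsion_surjective S ρ (k + 1) b
  rw [cofreeTorsionPow_divPowCofreeMkTorsion, cofreeTorsionPow_divPowCofreeMkTorsion]
  exact (htower hζsucc k s t).symm

end Tower

/-! ## §4 The crux's `ρ`: `det ρ = ε₂` from the Frobenius polynomials, hence THE pinned `ℤ_2`-valued family exists -/

section Crux

open Polynomial Rat.HeightOneSpectrum

variable (S : Set (PadicAlgCl 2)) (ρ : FramedGaloisRep ℚ ↥(padicCoeffIntegers S) 2) {M : ℕ}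
  (a : HeightOneSpectrum (𝓞 ℚ) → PadicAlgCl 2)
  (hρ : ∀ v : HeightOneSpectrum (𝓞 ℚ), ¬ natGenerator v ∣ 2 * M →
    ρ.IsUnramifiedAt v ∧ ∃ P : Polynomial ↥(padicCoeffIntegers S), P.map (padicCoeffIntegers S).subtype =
      X ^ 2 - C (a v) * X + C ((natGenerator v : ℕ) : PadicAlgCl 2) ∧ ρ.HasFrobCharpolyAt v P)

include hρ in
/-- `det ρ = ε₂` INSIDE `𝒪` for the crux's `ρ` (binder `hρ` of RSL_g: unramified with Frobenius polynomial `X² − a_v X + ℓ_v` at every `v ∤ 2M`),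
from p674333 `det_eq_cyclotomicCharacter_of_frobCharpoly_shape` (continuity + Chebotarev, unconditional) read through the framed/unframed
dictionary `FramedGaloisRep.hasFrobCharpolyAt_toGaloisRep_iff`. [cite: DarmonDiamondTaylor1995, Thm. 3.1 (d)] [cite: SerreAbelianLadic1968, Ch. I §2.3] -/
theorem det_eq_padicIntToCoeffIntegers_cyclotomicCharacter_of_crux [NeZero M] (σ : absoluteGaloisGroup ℚ) :
    ((FramedRep.det ρ σ : (↥(padicCoeffIntegers S))ˣ) : ↥(padicCoeffIntegers S)) =
      padicIntToCoeffIntegers S ((GaloisRep.cyclotomicCharacter ℚ 2 σ : ℤ_[2]ˣ) : ℤ_[2]) :=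
  det_eq_padicIntToCoeffIntegers_cyclotomicCharacter S ρ
    (det_eq_cyclotomicCharacter_of_frobCharpoly_shape S ρ (NeZero.ne M) a fun v hv =>
      (hρ v hv).2.elim fun P hP => ⟨P, hP.1, (FramedGaloisRep.hasFrobCharpolyAt_toGaloisRep_iff v P ρ).mpr hP.2⟩) σ

include hρ in
/-- **K-b2 for the crux: THE pinned `ℤ_2`-valued `ρ`-coefficient layer Tate pairing EXISTS.** For the crux's `ρ` (`hρ`), every `ℤ_2`-linear
`λ : 𝒪 →+ ℤ_2`, every transport `Θ : A_ρ ≃ E[2^∞]^r` equivariant at `v` and the cyclotomic tower `κ`: there are tower data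
`(ePk, hμ, hadd₁, hadd₂, hgal)` (value formula `e_k(2^{-k}s, 2^{-k}t) = ζ_k^{λ(s∧t)}`, primitive compatible `ζ`) such that the finite-coefficient
pairings `rhoLayerPairingPk … n k` are COMPATIBLE along `ℤ/2^{k+1} → ℤ/2^k` at every layer `n` (`hcompat`), and a family
`pair n : H¹(Γ_n, T_ρ) →+ (E(ℚ_{n,v})^r →+ ℤ_2)` with residues `toZModPow k (pair n x Q) = rhoLayerPairingPk … n k x Q` — namely
`rhoLayerPairingAdic … n (hcompat n)`; it is the ONLY such family (`CyclotomicLayer.eq_of_forall_toZModPow_eq_rhoLayerPairingPk`).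
[cite: PerrinRiou1994Invent, §3.6.1] [cite: Kato2004Asterisque, §13.8 (pp. 228–229) and §14.9 (p. 239)] [cite: Kobayashi2003, (8.23) (p. 18)] -/
theorem exists_rhoLayerPairing_pinned_of_crux [NeZero M]
    (lam : ↥(padicCoeffIntegers S) →+ ℤ_[2]) (hlam : ∀ (z : ℤ_[2]) (x : ↥(padicCoeffIntegers S)), lam (padicIntToCoeffIntegers S z * x) = z * lam x)
    (W : WeierstrassCurve ℚ) [W.IsElliptic] {r : ℕ} (Θ : Cofree ρ ↥(padicCoeffField S) ≃+ (Fin r → ↥(W.geomPrimaryTorsion 2)))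
    (κ : ZpExtension ℚ 2) (v : HeightOneSpectrum (𝓞 ℚ))
    (hΘ : ∀ (δ : absoluteGaloisGroup (v.adicCompletion ℚ)) (m : Cofree ρ ↥(padicCoeffField S)) (i : Fin r),
      Θ (resGalOfEmb (closureEmb (K := ℚ) (v.adicCompletion ℚ)) δ • m) i =
        resGalOfEmb (closureEmb (K := ℚ) (v.adicCompletion ℚ)) δ • Θ m i) :
    ∃ (ePk : ∀ k : ℕ, ↥(AddSubgroup.torsionBy (Cofree ρ ↥(padicCoeffField S)) ((2 ^ k : ℕ) : ℤ)) →
        ↥(AddSubgroup.torsionBy (Cofree ρ ↥(padicCoeffField S)) ((2 ^ k : ℕ) : ℤ)) → AlgebraicClosure ℚ)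
      (hμPk : ∀ k a b, ePk k a b ^ (2 ^ k) = 1)
      (hadd₁Pk : ∀ k a₁ a₂ b, ePk k (a₁ + a₂) b = ePk k a₁ b * ePk k a₂ b)
      (hadd₂Pk : ∀ k a b₁ b₂, ePk k a (b₁ + b₂) = ePk k a b₁ * ePk k a b₂)
      (hgalPk : ∀ k (σ : absoluteGaloisGroup ℚ) (a b : ↥(AddSubgroup.torsionBy (Cofree ρ ↥(padicCoeffField S)) ((2 ^ k : ℕ) : ℤ))),
        σ • ePk k a b = ePk k (cofreeTorsionGaloisModule S ρ _ σ a) (cofreeTorsionGaloisModule S ρ _ σ b))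
      (hcompat : ∀ (n k : ℕ) (x : H1 (FramedGaloisRep.toGaloisRep ρ) (κ.layerSubgroup n))
        (Q : Fin r → localLayerPointsOfEmb κ (closureEmb (K := ℚ) (v.adicCompletion ℚ)) W n),
        (ZMod.cast (rhoLayerPairingPk S ρ W ePk hμPk hadd₁Pk hadd₂Pk hgalPk Θ κ v hΘ n (k + 1) x Q) : ZMod (2 ^ k)) =
          rhoLayerPairingPk S ρ W ePk hμPk hadd₁Pk hadd₂Pk hgalPk Θ κ v hΘ n k x Q),
      (∃ ζ : ℕ → AlgebraicClosure ℚ, (∀ k, IsPrimitiveRoot (ζ k) (2 ^ k)) ∧ (∀ k, ζ (k + 1) ^ 2 = ζ k) ∧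
        ∀ k (s t : Fin 2 → ↥(padicCoeffIntegers S)),
          ePk k (divPowCofreeMkTorsion S ρ k s) (divPowCofreeMkTorsion S ρ k t) =
            ζ k ^ (PadicInt.toZModPow k (lam (s 0 * t 1 - s 1 * t 0))).val) ∧
      (∀ k (a b : ↥(AddSubgroup.torsionBy (Cofree ρ ↥(padicCoeffField S)) ((2 ^ (k + 1) : ℕ) : ℤ))),
        ePk k ((cofreeTorsionPow S ρ k).hom a) ((cofreeTorsionPow S ρ k).hom b) = ePk (k + 1) a b ^ 2) ∧
      ∃ pair : ∀ n : ℕ, H1 (FramedGaloisRep.toGaloisRep ρ) (κ.layerSubgroup n) →+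
          ((Fin r → localLayerPointsOfEmb κ (closureEmb (K := ℚ) (v.adicCompletion ℚ)) W n) →+ ℤ_[2]),
        (∀ n, pair n = rhoLayerPairingAdic S ρ W ePk hμPk hadd₁Pk hadd₂Pk hgalPk Θ κ v hΘ n (hcompat n)) ∧
        ∀ (n k : ℕ) (x : H1 (FramedGaloisRep.toGaloisRep ρ) (κ.layerSubgroup n))
          (Q : Fin r → localLayerPointsOfEmb κ (closureEmb (K := ℚ) (v.adicCompletion ℚ)) W n),
          PadicInt.toZModPow k (pair n x Q) = rhoLayerPairingPk S ρ W ePk hμPk hadd₁Pk hadd₂Pk hgalPk Θ κ v hΘ n k x Q := by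
  obtain ⟨ePk, hμ, hadd₁, hadd₂, hgal, hval, htower⟩ :=
    exists_cofreeWedgeTower_pow S ρ (det_eq_padicIntToCoeffIntegers_cyclotomicCharacter_of_crux S ρ a hρ) lam hlam
  have hcompat : ∀ (n k : ℕ) (x : H1 (FramedGaloisRep.toGaloisRep ρ) (κ.layerSubgroup n))
      (Q : Fin r → localLayerPointsOfEmb κ (closureEmb (K := ℚ) (v.adicCompletion ℚ)) W n),
      (ZMod.cast (rhoLayerPairingPk S ρ W ePk hμ hadd₁ hadd₂ hgal Θ κ v hΘ n (k + 1) x Q) : ZMod (2 ^ k)) =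
        rhoLayerPairingPk S ρ W ePk hμ hadd₁ hadd₂ hgal Θ κ v hΘ n k x Q :=
    fun n k x Q => rhoLayerPairingPk_succ_compat S ρ W ePk hμ hadd₁ hadd₂ hgal htower Θ κ v hΘ n k x Q
  exact ⟨ePk, hμ, hadd₁, hadd₂, hgal, hcompat, hval, htower,
    fun n => rhoLayerPairingAdic S ρ W ePk hμ hadd₁ hadd₂ hgal Θ κ v hΘ n (hcompat n), fun _ => rfl,
    fun n k x Q => toZModPow_rhoLayerPairingAdic S ρ W ePk hμ hadd₁ hadd₂ hgal Θ κ v hΘ n (hcompat n) k x Q⟩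

end Crux

end Summit.BirchSwinnertonDyer.BirchSwinnertonDyer.Theorems.ThetaTransport

end
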